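import Literature.NumberTheory.IwasawaTheory.CyclotomicTwoTotallyRamifiedNoSqrtTwo
import Literature.NumberTheory.IwasawaTheory.ClassicalMuVanishesImaginaryQuadraticTwoProofs
import Literature.NumberTheory.QuadraticFields.DiscriminantOfSqrt
import HarnessLib

/-!
# Fukuda's index is `0` for the cyclotomic `ℤ₂`-extension of `ℚ(√−d)`, `d ≡ 1 (mod 4)`: the dyadic prime is totally ramified from the bottom
# (an Eisenstein quartic in `K₁ = K(√2)`; proved; no definition, no named fact)

Topic `NumberTheory/IwasawaTheory` (namespace = path).  THEOREM-ONLY file, written by the prover seat `bsd-line-att-p3` g32 (cell `bsd-f1-sign2`; `--supports`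
stmt-BirchSwinnertonDyer-22298; closes nothing).  Companion of `CyclotomicTwoTotallyRamifiedOddIndex.lean` / `…NoSqrtTwo.lean` (Fukuda index `0` when the
primes above `2` have ODD ramification index); here `[K : ℚ] = 2` and `e(w ∣ 2) = 2`, so those criteria do not apply, and the input is an explicit uniformiser.

THE COMPUTATION.  `K ∋ η` with `η² = −d`, `d = 4m + 1`; `K₁ = K(√2)` (any cyclotomic `ℤ₂`-extension of `K` has `√2 ∈ K₁`, tree
`exists_sq_eq_two_layer_one_of_forall_sq_ne_two`).  Then `β = (1 + η)/√2` has `β² = η − 2m`, `β⁴ + 4mβ² + (2m+1)² = 0`, and `θ = β − 1` is a root of the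
EISENSTEIN quartic `X⁴ + 4X³ + (6 + 4m)X² + (4 + 8m)X + 2(2m² + 4m + 1)`.  §1: a root `θ` of such a quartic in a number field `L` forces `4 ∣ e(Q ∣ 2)` for every
prime `Q ∣ 2` of `L` (`θ⁴ = 2v` with `v ≡ −(2m²+4m+1) (mod Q)` a `Q`-unit, so `ord_Q(2) = 4·ord_Q(θ)`).  §2: `e(Q ∣ 2) = e(w ∣ 2)·e(Q ∣ w)` with `e(w ∣ 2) ≤ 2`
gives `e(Q ∣ w) ≠ 1`: the dyadic prime `w` of `K` RAMIFIES in `K₁`, hence (tree `totallyRamifiedFrom_zero_of_forall_not_isUnramifiedIn_layer_one`, Washington's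
proof of Lemma 13.3) ★ `totallyRamifiedFrom_zero_of_sq_eq_neg_of_mod_four_eq_one`: **`TotallyRamifiedFrom κ 0` for every cyclotomic `ℤ₂`-extension `κ` of `K`.**
§0 records `d_K = −4d`, `K` imaginary quadratic, `√2 ∉ K` for `K ∋ √−d`, `d ≡ 1, 2 (mod 4)` squarefree.

References: [Washington1997] §13.1, Prop. 13.2, Lemma 13.3 (proof); [Fukuda1994] p. 264 (the index `n₀`); [NeukirchANT1999] Ch. I §8 (multiplicativity of `e`),
Ch. II §6 (Eisenstein polynomials and total ramification); [Marcus2018] Ch. 2 Thm. 1 (`d_K = 4m`); [Ferrero1980AJM] §2 (the tower `K·ℚ_n`).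
-/

set_option autoImplicit false

noncomputable section

open scoped NumberField Pointwise
open Polynomial NumberField IsDedekindDomain UniqueFactorizationMonoid

namespace Literature.NumberTheory.IwasawaTheory

open Literature.NumberTheory.EllipticCurves Literature.NumberTheory.GaloisRepresentations Field
  Literature.NumberTheory.QuadraticFields

/-! ## §0 `K ∋ √−d`, `d ≡ 1, 2 (mod 4)`: `d_K = −4d`, imaginary quadratic, `√2 ∉ K` -/

section Basic

variable (K : Type) [Field K] [NumberField K]

/-- **`K ∋ η`, `η² = −d`, `d > 0`, `[K : ℚ] = 2` ⟹ `K` is imaginary quadratic.** [cite: Washington1997, §13.1] -/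
theorem isImaginaryQuadratic_of_sq_eq_neg (hK2 : Module.finrank ℚ K = 2) {d : ℕ} (hd : 0 < d) (hη : ∃ η : K, η ^ 2 = -((d : ℕ) : K)) :
    IsImaginaryQuadratic K := by
  obtain ⟨η, hη⟩ := hη
  have hneg : -(d : ℚ) < 0 := by
    have : (0 : ℚ) < d := by exact_mod_cast hd
    linarith
  exact IsImaginaryQuadratic.of_sq_eq hK2 (θ := η) (c := -(d : ℚ)) (by rw [hη, map_neg, map_natCast]) hneg

/-- **`d_K = −4d` for `K ∋ η`, `η² = −d`, `d ≡ 1, 2 (mod 4)` squarefree** (`−d ≡ 3, 2 (mod 4)`; Marcus Ch. 2 Thm. 1). [cite: Marcus2018, Ch. 2 Thm. 1] -/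
theorem discr_eq_neg_four_mul_of_sq_eq_neg (hK2 : Module.finrank ℚ K = 2) {d : ℕ} (hsf : Squarefree d) (hd4 : d % 4 = 1 ∨ d % 4 = 2)
    (hη : ∃ η : K, η ^ 2 = -((d : ℕ) : K)) : NumberField.discr K = -(4 * (d : ℤ)) := by
  obtain ⟨η, hη⟩ := hη
  have hsq : η ^ 2 = ((-(d : ℤ) : ℤ) : K) := by rw [hη]; push_cast; ring
  have hsf' : Squarefree (-(d : ℤ)) := Int.squarefree_natAbs.mp (by rw [Int.natAbs_neg, Int.natAbs_natCast]; exact hsf)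
  have h := Quadratic.discr_eq_four_mul_of_sq_eq_intCast hK2 hsq (by omega) hsf'
  rw [h]; ring

/-- **`√2 ∉ K` for an imaginary quadratic `K`** (`x² = 2`, `x ∉ ℚ` would give `d_K = 2q² > 0`). [cite: Washington1997, §13.1] -/
theorem sq_ne_two_of_isImaginaryQuadratic (hK : IsImaginaryQuadratic K) (x : K) : x ^ 2 ≠ 2 := by
  intro hx
  have hx' : x ^ 2 = algebraMap ℚ K 2 := by rw [hx, map_ofNat]
  have hxK : x ∉ Set.range (algebraMap ℚ K) := by
    rintro ⟨q, rfl⟩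
    have hq : (q : ℝ) ^ 2 = 2 := by
      rw [← map_pow] at hx'
      have := (algebraMap ℚ K).injective hx'
      exact_mod_cast congrArg (fun r : ℚ ↦ (r : ℝ)) this
    refine irrational_sqrt_two ⟨|q|, ?_⟩
    rw [Rat.cast_abs, ← Real.sqrt_sq_eq_abs, hq]
  obtain ⟨q, hq0, hq⟩ := NumberField.exists_discr_eq_mul_sq hK.1 hxK hx'
  have hneg : (NumberField.discr K : ℚ) < 0 := by exact_mod_cast hK.discr_neg
  have hpos : (0 : ℚ) < 2 * q ^ 2 := by positivity
  linarith

end Basic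

/-! ## §1 A root of the Eisenstein quartic forces `4 ∣ e(Q ∣ 2)` -/

section Quartic

variable {L : Type} [Field L] [NumberField L]

omit [NumberField L] in
/-- A root of `X⁴ + 4X³ + (6+4m)X² + (4+8m)X + (4m²+8m+2)` (`m ∈ ℤ`) is an algebraic integer. [cite: NeukirchANT1999, Ch. I §2 (integrality of roots of monic integer
polynomials)] -/
private theorem isIntegral_int_of_eisenstein_quartic_root {θ : L} {m : ℤ}
    (hθ : θ ^ 4 + 4 * θ ^ 3 + (6 + 4 * (m : L)) * θ ^ 2 + (4 + 8 * (m : L)) * θ + (4 * (m : L) ^ 2 + 8 * m + 2) = 0) : IsIntegral ℤ θ := by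
  refine ⟨X ^ 4 + C 4 * X ^ 3 + C (6 + 4 * m) * X ^ 2 + C (4 + 8 * m) * X + C (4 * m ^ 2 + 8 * m + 2), by monicity!, ?_⟩
  simp only [eval₂_add, eval₂_mul, eval₂_C, eval₂_X_pow, eval₂_X]
  simp only [map_add, map_mul, map_pow, map_ofNat, eq_intCast]
  linear_combination hθ

/-- **`4 ∣ e(Q ∣ 2)` from a root of the Eisenstein quartic.**  If `θ⁴ + 4θ³ + (6+4m)θ² + (4+8m)θ + (4m²+8m+2) = 0` in the number field `L` (`m ∈ ℤ`), then for every
prime `Q` of `𝓞 L` above `2`: `4 ∣ e(Q ∣ 2)`.  Indeed `θ⁴ = 2v` with `v = −(2θ³ + (3+2m)θ² + (2+4m)θ + (2m²+4m+1))`, `θ ∈ Q`, and `v ∉ Q` (else the odd integer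
`2m²+4m+1 ∈ Q ∋ 2`), so `(θ)⁴ = (2)(v)` and the exponent of `Q` in `2𝓞_L` is `4·ord_Q(θ)`. [cite: NeukirchANT1999, Ch. II §6 (Eisenstein polynomials) and Ch. I §8 Prop. (8.2)]
[cite: Washington1997, Prop. 13.2 and Lemma 13.3] -/
theorem four_dvd_ramificationIdx_int_of_eisenstein_quartic_root {θ : L} {m : ℤ}
    (hθ : θ ^ 4 + 4 * θ ^ 3 + (6 + 4 * (m : L)) * θ ^ 2 + (4 + 8 * (m : L)) * θ + (4 * (m : L) ^ 2 + 8 * m + 2) = 0) (Q : Ideal (𝓞 L))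
    [hQ : Q.IsPrime] [hQ2 : Q.LiesOver (Ideal.span {(2 : ℤ)})] : 4 ∣ Q.ramificationIdx ℤ := by
  classical
  set θ' : 𝓞 L := ⟨θ, isIntegral_int_of_eisenstein_quartic_root hθ⟩ with hθ'
  set v : 𝓞 L := -(2 * θ' ^ 3 + (3 + 2 * (m : 𝓞 L)) * θ' ^ 2 + (2 + 4 * (m : 𝓞 L)) * θ' + (2 * (m : 𝓞 L) ^ 2 + 4 * m + 1)) with hv
  have hθ4 : θ' ^ 4 = 2 * v := by
    apply Subtype.ext
    change ((θ' ^ 4 : 𝓞 L) : L) = ((2 * v : 𝓞 L) : L)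
    rw [hv]
    push_cast
    change θ ^ 4 = 2 * -(2 * θ ^ 3 + (3 + 2 * (m : L)) * θ ^ 2 + (2 + 4 * (m : L)) * θ + (2 * (m : L) ^ 2 + 4 * m + 1))
    linear_combination hθ
  -- `2 ∈ Q`, `θ ∈ Q`, `v ∉ Q`
  have h2Q : (2 : 𝓞 L) ∈ Q := by
    have h := Ideal.mem_span_singleton_self (2 : ℤ)
    rw [hQ2.over, Ideal.under_def, Ideal.mem_comap, map_ofNat] at h
    exact h
  have hθQ : θ' ∈ Q := hQ.mem_of_pow_mem 4 (by rw [hθ4]; exact Q.mul_mem_right _ h2Q)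
  have hvQ : v ∉ Q := by
    intro hvQ
    have hodd : (2 * (m : 𝓞 L) ^ 2 + 4 * m + 1 : 𝓞 L) ∈ Q := by
      have : (2 * (m : 𝓞 L) ^ 2 + 4 * m + 1 : 𝓞 L) = -v - θ' * (2 * θ' ^ 2 + (3 + 2 * (m : 𝓞 L)) * θ' + (2 + 4 * (m : 𝓞 L))) := by
        rw [hv]; ring
      rw [this]
      exact Q.sub_mem (Q.neg_mem_iff.mpr hvQ) (Q.mul_mem_right _ hθQ)
    have hone : (1 : 𝓞 L) ∈ Q := by
      have : (1 : 𝓞 L) = (2 * (m : 𝓞 L) ^ 2 + 4 * m + 1) - 2 * ((m : 𝓞 L) ^ 2 + 2 * m) := by ring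
      rw [this]
      exact Q.sub_mem hodd (Q.mul_mem_right _ h2Q)
    exact hQ.ne_top ((Ideal.eq_top_iff_one Q).mpr hone)
  -- `(θ)⁴ = (2)·(v)`
  have hv0 : v ≠ 0 := fun h => hvQ (by rw [h]; exact Q.zero_mem)
  have hθ0 : θ' ≠ 0 := by
    intro h
    apply hv0
    have := hθ4
    rw [h, zero_pow (by norm_num)] at this
    rcases mul_eq_zero.mp this.symm with h2 | h2
    · exact absurd h2 (by exact_mod_cast (two_ne_zero : (2 : 𝓞 L) ≠ 0))
    · exact h2
  have hspan : Ideal.span {θ'} ^ 4 = Ideal.span {(2 : 𝓞 L)} * Ideal.span {v} := by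
    rw [Ideal.span_singleton_pow, hθ4, Ideal.span_singleton_mul_span_singleton]
  have hmap : Ideal.map (algebraMap ℤ (𝓞 L)) (Ideal.span {(2 : ℤ)}) = Ideal.span {(2 : 𝓞 L)} := by
    rw [Ideal.map_span, Set.image_singleton, map_ofNat]
  have hp0 : Ideal.map (algebraMap ℤ (𝓞 L)) (Ideal.span {(2 : ℤ)}) ≠ ⊥ :=
    Ideal.map_ne_bot_of_ne_bot (by simp)
  have h2ne : (Ideal.span {(2 : 𝓞 L)} : Ideal (𝓞 L)) ≠ ⊥ := by rw [← hmap]; exact hp0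
  have hvne : (Ideal.span {v} : Ideal (𝓞 L)) ≠ ⊥ := by rw [Ne, Ideal.span_singleton_eq_bot]; exact hv0
  have hθne : (Ideal.span {θ'} : Ideal (𝓞 L)) ≠ ⊥ := by rw [Ne, Ideal.span_singleton_eq_bot]; exact hθ0
  have hcountv : Multiset.count Q (normalizedFactors (Ideal.span {v})) = 0 := by
    rw [Multiset.count_eq_zero]
    intro hmem
    exact hvQ (Ideal.dvd_span_singleton.mp (dvd_of_mem_normalizedFactors hmem))
  have hcount : Multiset.count Q (normalizedFactors (Ideal.span {(2 : 𝓞 L)})) = 4 * Multiset.count Q (normalizedFactors (Ideal.span {θ'})) := by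
    have h := congrArg (fun I => Multiset.count Q (normalizedFactors I)) hspan
    rw [normalizedFactors_pow, Multiset.count_nsmul, normalizedFactors_mul h2ne hvne, Multiset.count_add, hcountv, add_zero] at h
    exact h.symm
  rw [Ideal.IsDedekindDomain.ramificationIdx_eq_normalizedFactors_count (Ideal.span {(2 : ℤ)}) Q hp0, hmap, hcount]
  exact dvd_mul_right 4 _

end Quartic

/-! ## §2 The dyadic prime of `ℚ(√−d)`, `d ≡ 1 (mod 4)`, ramifies in `K₁`; Fukuda's index `0` -/

section Tower

variable (K : Type) [Field K] [NumberField K]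

omit [NumberField K] in
/-- A place of `K` containing `2` lies over `(2) ⊂ ℤ`. [folklore] -/
private theorem liesOver_span_two_of_mem (w : HeightOneSpectrum (𝓞 K)) (hw : ((2 : ℕ) : 𝓞 K) ∈ w.asIdeal) :
    w.asIdeal.LiesOver (Ideal.span {(2 : ℤ)}) := by
  rw [Ideal.liesOver_span_iff w.isPrime.ne_top Int.prime_two, map_ofNat]
  exact_mod_cast hw

/-- **The Eisenstein quartic has a root in `K₁`.**  `[K : ℚ] = 2`, `K ∋ η` with `η² = −d`, `d ≡ 1 (mod 4)`, `κ` a cyclotomic `ℤ₂`-extension of `K`: with `√2 = s ∈ K₁` and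
`m = (d−1)/4`, the element `θ = (1 + η)/s − 1 ∈ K₁` satisfies `θ⁴ + 4θ³ + (6+4m)θ² + (4+8m)θ + (4m²+8m+2) = 0`. [cite: Washington1997, §13.1 (`K₁ = K(√2)`)] -/
theorem exists_eisenstein_quartic_root_layer_one (hK2 : Module.finrank ℚ K = 2) {d : ℕ} (hd4 : d % 4 = 1)
    (hη : ∃ η : K, η ^ 2 = -((d : ℕ) : K)) (κ : ZpExtension K 2) (hκ : κ.IsCyclotomic) :
    ∃ (m : ℤ) (θ : κ.layer 1),
      θ ^ 4 + 4 * θ ^ 3 + (6 + 4 * (m : κ.layer 1)) * θ ^ 2 + (4 + 8 * (m : κ.layer 1)) * θ + (4 * (m : κ.layer 1) ^ 2 + 8 * m + 2) = 0 := by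
  have hd0 : 0 < d := by omega
  have hIQ := isImaginaryQuadratic_of_sq_eq_neg K hK2 hd0 hη
  obtain ⟨η, hη⟩ := hη
  obtain ⟨s, hs⟩ := exists_sq_eq_two_layer_one_of_forall_sq_ne_two (by rw [hK2]; decide) (sq_ne_two_of_isImaginaryQuadratic K hIQ) κ hκ
  set m : ℤ := ((d : ℤ) - 1) / 4 with hm
  have hdm : (d : ℤ) = 4 * m + 1 := by omega
  set η₁ : κ.layer 1 := algebraMap K (κ.layer 1) η with hη₁
  have hdK : ((d : ℕ) : κ.layer 1) = 4 * (m : κ.layer 1) + 1 := by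
    have : ((d : ℤ) : κ.layer 1) = ((4 * m + 1 : ℤ) : κ.layer 1) := by rw [hdm]
    push_cast at this
    exact this
  have hη₁sq : η₁ ^ 2 = -(4 * (m : κ.layer 1) + 1) := by
    rw [hη₁, ← map_pow, hη, map_neg, map_natCast, hdK]
  have hs0 : s ≠ 0 := by
    intro h; rw [h, zero_pow two_ne_zero] at hs; exact two_ne_zero hs.symm
  refine ⟨m, (1 + η₁) * s⁻¹ - 1, ?_⟩
  have key : ((1 + η₁) * s⁻¹) ^ 2 = η₁ - 2 * m := by
    rw [mul_pow, inv_pow, hs]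
    have : (1 + η₁) ^ 2 = 2 * (η₁ - 2 * m) := by linear_combination hη₁sq
    rw [this]; field_simp
  have key4 : ((1 + η₁) * s⁻¹) ^ 4 = (η₁ - 2 * m) ^ 2 := by
    rw [show (4 : ℕ) = 2 * 2 from rfl, pow_mul, key]
  set β := (1 + η₁) * s⁻¹ with hβ
  linear_combination key4 + 4 * (m : κ.layer 1) * key + hη₁sq

/-- **The dyadic prime of `K` ramifies in the first layer `K₁`.**  Same hypotheses; for every place `w ∣ 2` of `K`: `w` is RAMIFIED in `K₁ = κ.layer 1` (`e(Q ∣ 2) = e(w ∣ 2)·e(Q ∣ w)`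
is divisible by `4`, §1, while `e(w ∣ 2) ≤ [K : ℚ] = 2`). [cite: Washington1997, §13.1 and Prop. 13.2] [cite: NeukirchANT1999, Ch. I §8 Prop. (8.2)] -/
theorem not_isUnramifiedIn_layer_one_of_sq_eq_neg (hK2 : Module.finrank ℚ K = 2) {d : ℕ} (hd4 : d % 4 = 1)
    (hη : ∃ η : K, η ^ 2 = -((d : ℕ) : K)) (κ : ZpExtension K 2) (hκ : κ.IsCyclotomic) {w : HeightOneSpectrum (𝓞 K)}
    (hw : ((2 : ℕ) : 𝓞 K) ∈ w.asIdeal) : ¬ Algebra.IsUnramifiedIn (𝓞 (κ.layer 1)) w.asIdeal := by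
  haveI : Fact (Nat.Prime 2) := ⟨Nat.prime_two⟩
  haveI : FiniteDimensional K (κ.layer 1) := κ.finiteDimensional_layer_holds 1
  haveI : NumberField (κ.layer 1) := NumberField.of_module_finite K _
  intro hunr
  obtain ⟨m, θ, hθ⟩ := exists_eisenstein_quartic_root_layer_one K hK2 hd4 hη κ hκ
  haveI : w.asIdeal.IsPrime := w.isPrime
  haveI := liesOver_span_two_of_mem K w hw
  obtain ⟨⟨Q, hQprime, hQover⟩⟩ := (inferInstance : Nonempty (Ideal.primesOver w.asIdeal (𝓞 (κ.layer 1))))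
  haveI := hQprime
  haveI := hQover
  haveI : Q.LiesOver (Ideal.span {(2 : ℤ)}) := Ideal.LiesOver.trans Q w.asIdeal _
  have h1 : Q.ramificationIdx (𝓞 K) = 1 := hunr.ramificationIdx_eq_one hQover
  have hfour := four_dvd_ramificationIdx_int_of_eisenstein_quartic_root hθ Q
  rw [Ideal.ramificationIdx_tower w.asIdeal Q, h1, mul_one] at hfour
  -- `e(w ∣ 2) ≤ 2`
  haveI : (Ideal.span {(2 : ℤ)}).IsMaximal := ((Ideal.span_singleton_prime two_ne_zero).mpr Int.prime_two).isMaximal (by simp)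
  have hle : w.asIdeal.ramificationIdx ℤ ≤ Module.finrank ℚ K := by
    rw [← Ideal.ramificationIdx'_eq_ramificationIdx (Ideal.span {(2 : ℤ)}) w.asIdeal (by simp)]
    exact Ideal.ramificationIdx_le_finrank (𝓞 K) ℚ K w.asIdeal
  have hpos : 0 < w.asIdeal.ramificationIdx ℤ := Ideal.ramificationIdx_pos w.asIdeal ℤ
  have h4 := Nat.le_of_dvd hpos hfour
  omega

/-- ★ **Fukuda's index is `0` for `ℚ(√−d)`, `d ≡ 1 (mod 4)`.**  `[K : ℚ] = 2`, `K ∋ η` with `η² = −d`, `d ≡ 1 (mod 4)`: every cyclotomic `ℤ₂`-extension `κ` of `K` has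
`TotallyRamifiedFrom κ 0` — every prime of `ℤ̄_K` is unramified or TOTALLY ramified in `K_∞/K` (the dyadic prime ramifies in `K₁`, so its inertia group is all of `ℤ₂`;
Washington's proof of Lemma 13.3). [cite: Washington1997, §13.1 Lemma 13.3 (proof)] [cite: Fukuda1994, p. 264] [cite: Ferrero1980AJM, §2] -/
theorem totallyRamifiedFrom_zero_of_sq_eq_neg_of_mod_four_eq_one (hK2 : Module.finrank ℚ K = 2) {d : ℕ} (hd4 : d % 4 = 1)
    (hη : ∃ η : K, η ^ 2 = -((d : ℕ) : K)) (κ : ZpExtension K 2) (hκ : κ.IsCyclotomic) : TotallyRamifiedFrom κ 0 :=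
  haveI : Fact (Nat.Prime 2) := ⟨Nat.prime_two⟩
  totallyRamifiedFrom_zero_of_forall_not_isUnramifiedIn_layer_one κ fun _ hw =>
    not_isUnramifiedIn_layer_one_of_sq_eq_neg K hK2 hd4 hη κ hκ hw

end Tower

end Literature.NumberTheory.IwasawaTheory

end
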